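import Mathlib
import Summits.Ventures.PercRepro.PuncturedLYMMixP1Q4Table1

/-!
# PercRepro — (SP) FOR `1` PAIRWISE DISJOINT PAIRS AND `4` PAIRWISE DISJOINT QUADRUPLES AT LEVEL `4`: POSITIVITY OF THE DENOMINATORS (1)
(p10, gen 41)

`den > 0`, `Pc > 0` for `n ≥ 18`; `Yc > 0` for `n ≥ 5`.  Nothing here asserts (SP).
-/

namespace PercRepro.PuncturedLYM.Split.TypeLift.MixP1Q4

/-- `den > 0` for `n ≥ 18`. -/
theorem den_pos (n : ℚ) (hn : 18 ≤ n) : 0 < den n := by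
  obtain ⟨n', hn', rfl⟩ : ∃ n', 0 ≤ n' ∧ n = 18 + n' := ⟨n - 18, by linarith, by ring⟩
  have h : den (18 + n') = 55296 * n' ^ 12 + 11008512 * n' ^ 11 + 1003125120 * n' ^ 10 + 55323970656 * n' ^ 9 + 2056812514512 * n' ^ 8 + 54304353447312 * n' ^ 7 + 1044052557145152 * n' ^ 6 + 14727716258596608 * n' ^ 5 + 151283030598550224 * n' ^ 4 + 1103548898407645968 * n' ^ 3 + 5426228304909083808 * n' ^ 2 + 16147761090508560384 * n' + 21993191289739837440 := by unfold den; ring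
  rw [h]; positivity

/-- `Yc > 0` for `n ≥ 5`. -/
theorem Yc_pos (n : ℚ) (hn : 5 ≤ n) : 0 < Yc n := by
  obtain ⟨n', hn', rfl⟩ : ∃ n', 0 ≤ n' ∧ n = 5 + n' := ⟨n - 5, by linarith, by ring⟩
  have h : Yc (5 + n') = (1 / 120) * n' ^ 5 + (1 / 8) * n' ^ 4 + (17 / 24) * n' ^ 3 + (15 / 8) * n' ^ 2 + (137 / 60) * n' + 1 := by unfold Yc; ring
  rw [h]; positivity

/-- `Pc > 0` for `n ≥ 18`. -/
theorem Pc_pos (n : ℚ) (hn : 18 ≤ n) : 0 < Pc n := by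
  obtain ⟨n', hn', rfl⟩ : ∃ n', 0 ≤ n' ∧ n = 18 + n' := ⟨n - 18, by linarith, by ring⟩
  have h : Pc (18 + n') = (1 / 24) * n' ^ 4 + (11 / 4) * n' ^ 3 + (1619 / 24) * n' ^ 2 + (2919 / 4) * n' + 2936 := by unfold Pc; ring
  rw [h]; positivity

end PercRepro.PuncturedLYM.Split.TypeLift.MixP1Q4
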